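import Summits.Ventures.LatticeQCDFlow.Scaling.DoeblinHotMixingCeiling

/-!
HONEST FRAMING: exact (Metropolis-corrected) sampling algorithms for lattice gauge theory; figures
of merit are autocorrelation/cost numbers at stated couplings and volumes; no continuum-physics
claim.

# DoeblinHotSampler — THE REALISTIC HOT LEVEL: A `μ_0`-STATIONARY HOT KERNEL WITH A DOEBLIN MINORISATION
# `M_0(u,·) ≥ a·μ_0(·)` (E.G. A METROPOLIS-CORRECTED INDEPENDENCE SAMPLER DRIVEN BY A NORMALIZING FLOW WHOSE
# IMPORTANCE WEIGHTS ARE BOUNDED BY `1/a`) KEEPS EVERY CHAPTER-M CEILING WITH `w_0 ↦ a·w_0`: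
# `d(n) ≤ ((2K+p)/p)·(1 − tcp/(2m))ⁿ` ONCE `4t ≤ p(1−t)·a·w_0`, AND `2(K+1)·(1 − t(1−t)·a·w_0·c/(2m))ⁿ` WITH PERFECT
# TRANSPORTS (lean-2 GEN-27, ours)

Venture-side (OURS).  Cell `lqcd-flow` (pub-lqcd), unit `pub-lqcd-lean-2-g27`, 2026-08-27.  Doeblin-minorised hot
samplers, file 5 — the user-facing statements.  THE SCHEME is chapter M's own: `P = t·GSw + (1−t)·Π_w^M` on
`Fin (K+1) → S` (hub list `e_r = (0, κ_r+1)` with `m ≥ 1` entries, every cold level listed `≥ c` times, maps `φ_r`,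
positive unit-mass laws `μ_k`, single-site kernels `M_k` with update weights `w_k`, `Σ_k w_k = 1`), EXCEPT that the
hot kernel `M_0` is no longer the exact sampler: it is only assumed `μ_0`-STATIONARY with the whole-space DOEBLIN
MINORISATION `M_0(u, v) ≥ a·μ_0(v)` (`0 < a ≤ 1`); all `M_k` are `μ_k`-stationary.

## What is proved

* §1 the Nummelin split of a minorised stationary kernel: `kernel_eq_of_minorization_one` (`a = 1` forces
  `M_0(u,·) = μ_0`), `doeblinResidual_nonneg`, `doeblinResidual_isRowStochastic`, `doeblinResidual_stationary`, `kernel_eq_doeblinResidual_mix`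
  (`M_0 = a·Ẽ + (1−a)·R`, `R = (M_0 − a·μ_0)/(1−a)`, `R := μ_0` if `a = 1`); **`doeblin_prodKernel_split`** —
  `Π_w^M = (a·w_0)·Ẽ_0 + Π_{w'}^{N}` with `N_0 = R`, `N_k = M_k`, `w'_0 = (1−a)w_0`, `w'_k = w_k`; `doeblin_scheme_eq`,
  `doeblin_weights`, `doeblin_residualFamily`.
* §2 **`doeblinStar_worstTvDist_le`** — one-sided domination `p·μ_{l_r}(φ_r u) ≤ μ_0(u)` (`0 < p ≤ 1`) and
  `4t ≤ p(1−t)·a·w_0` give `d(n) ≤ ((2K+p)/p)·(1 − tcp/(2m))ⁿ`; **`doeblinStar_mixingTime_le`** —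
  `t_mix(ε) ≤ ⌈(2m/(tcp))·log((2K+p)/(pε))⌉`; **`doeblinPerfectStar_worstTvDist_le`** — perfect transports,
  `0 < t < 1`, `w_0 > 0`: `d(n) ≤ 2(K+1)·(1 − t(1−t)·a·w_0·c/(2m))ⁿ`; **`doeblinPerfectStar_mixingTime_le`** —
  `t_mix(ε) ≤ ⌈(2m/(t(1−t)·a·w_0·c))·log(2(K+1)/ε)⌉`.

Reading (no numerics implied): for the flow-assisted hot-refreshed hub the hot level need not be an exact sampler —
a Metropolised independence sampler (or any `μ_0`-stationary kernel) that regenerates with probability `a` per hot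
update gives the same `K·log K`-type ceilings with the hot weight discounted to `a·w_0`: the transport quality `p`
and the hot sampler quality `a` enter only the regime `4t ≤ p(1−t)a·w_0` (one-sided case) or the rate (perfect
case).  `Scaling/DominatedStarMixingCeiling` is the case `a = 1`, `Scaling/DominatedStarLazyHotSampler` the case
`M_0 = a·Ẽ + (1−a)·Id`.  NOT CLAIMED: anything for hot kernels without a whole-space minorisation (e.g. local
Metropolis or HMC at the hot level), the regime-free ceiling for imperfect maps, anything measured.  Literature grade
(cell rule): OWN RESULT (the split `M_0 = a·Ẽ + (1−a)·R` is the textbook Nummelin/Doeblin decomposition, used here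
as a two-line algebraic identity, not cited as a fact); no new bib keys.
-/

noncomputable section

open Finset Function
open Literature.Probability.MarkovChains

namespace Summit.Ventures.LatticeQCDFlow.Scaling

/-! ## §1 The Nummelin split of a minorised stationary kernel -/

section Split
variable {S : Type*} [Fintype S] {ν : S → ℝ} {P R : S → S → ℝ} {a : ℝ}

/-- **`a = 1`: a transition matrix with `P(u,·) ≥ ν(·)`, `Σ ν = 1`, IS the exact sampler `P(u,·) = ν`.** [ours] -/
theorem kernel_eq_of_minorization_one (hP : IsRowStochastic P) (hν1 : ∑ v, ν v = 1) (hmin : ∀ u v, ν v ≤ P u v)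
    (u v : S) : P u v = ν v := by
  have hsum : ∑ v', (P u v' - ν v') = 0 := by rw [Finset.sum_sub_distrib, hP.2 u, hν1, sub_self]
  have hzero := (Finset.sum_eq_zero_iff_of_nonneg (fun v' _ => sub_nonneg.mpr (hmin u v'))).mp hsum v (mem_univ _)
  linarith

omit [Fintype S] in
/-- The residual kernel `R = (P − a·ν)/(1−a)` (`R := ν` if `a = 1`) is non-negative (`P(u,·) ≥ a·ν(·)`, `ν ≥ 0`).
[ours] -/
theorem doeblinResidual_nonneg (hν0 : ∀ v, 0 ≤ ν v) (hmin : ∀ u v, a * ν v ≤ P u v)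
    (hR : ∀ u v, R u v = if a < 1 then (P u v - a * ν v) / (1 - a) else ν v) (u v : S) : 0 ≤ R u v := by
  rw [hR]
  split_ifs with ha
  · exact div_nonneg (by linarith [hmin u v]) (by linarith)
  · exact hν0 v

/-- **The residual kernel is a transition matrix** (`P` row-stochastic, `Σ ν = 1`, `ν ≥ 0`, `P(u,·) ≥ a·ν(·)`). [ours] -/
theorem doeblinResidual_isRowStochastic (hP : IsRowStochastic P) (hν0 : ∀ v, 0 ≤ ν v) (hν1 : ∑ v, ν v = 1)
    (hmin : ∀ u v, a * ν v ≤ P u v) (hR : ∀ u v, R u v = if a < 1 then (P u v - a * ν v) / (1 - a) else ν v) :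
    IsRowStochastic R := by
  refine ⟨doeblinResidual_nonneg hν0 hmin hR, fun u => ?_⟩
  by_cases ha : a < 1
  · simp_rw [hR, if_pos ha]
    rw [← Finset.sum_div, Finset.sum_sub_distrib, hP.2 u, ← Finset.mul_sum, hν1, mul_one]
    exact div_self (by linarith)
  · simp_rw [hR, if_neg ha]; exact hν1

/-- **The residual kernel is `ν`-stationary** when `P` is (`Σ_u ν(u)P(u,v) = ν(v)`, `Σ ν = 1`). [ours] -/
theorem doeblinResidual_stationary (hstat : ∀ v, ∑ u, ν u * P u v = ν v) (hν1 : ∑ v, ν v = 1)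
    (hR : ∀ u v, R u v = if a < 1 then (P u v - a * ν v) / (1 - a) else ν v) (v : S) :
    ∑ u, ν u * R u v = ν v := by
  by_cases ha : a < 1
  · simp_rw [hR, if_pos ha]
    have h1a : (1 - a) ≠ 0 := by linarith
    have e : ∀ u, ν u * ((P u v - a * ν v) / (1 - a)) = (ν u * P u v - a * ν v * ν u) / (1 - a) := fun u => by ring
    simp_rw [e]
    rw [← Finset.sum_div, Finset.sum_sub_distrib, hstat v, ← Finset.mul_sum, hν1, mul_one, div_eq_iff h1a]
    ring
  · simp_rw [hR, if_neg ha]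
    rw [← Finset.sum_mul, hν1, one_mul]

/-- **THE SPLIT `P = a·ν + (1−a)·R`** (`P` row-stochastic, `Σ ν = 1`, `P(u,·) ≥ a·ν(·)`, `a ≤ 1`). [ours] -/
theorem kernel_eq_doeblinResidual_mix (hP : IsRowStochastic P) (hν1 : ∑ v, ν v = 1) (hmin : ∀ u v, a * ν v ≤ P u v)
    (ha1 : a ≤ 1) (hR : ∀ u v, R u v = if a < 1 then (P u v - a * ν v) / (1 - a) else ν v) (u v : S) :
    P u v = a * ν v + (1 - a) * R u v := by
  rw [hR]
  by_cases ha : a < 1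
  · rw [if_pos ha]
    have h1a : (1 - a) ≠ 0 := by linarith
    rw [mul_div_assoc', mul_comm (1 - a), mul_div_assoc, div_self h1a, mul_one]
    ring
  · rw [if_neg ha]
    have ha' : a = 1 := le_antisymm ha1 (not_lt.mp ha)
    subst ha'
    rw [kernel_eq_of_minorization_one hP hν1 (fun u' v' => by have h := hmin u' v'; rwa [one_mul] at h) u v]
    ring

end Split

variable {S : Type*} [Fintype S] [DecidableEq S] {K m : ℕ} {μ : Fin (K + 1) → S → ℝ} {M : Fin (K + 1) → S → S → ℝ}
  {w : Fin (K + 1) → ℝ} {t p a : ℝ}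

section Doeblin
variable (κ : Fin m → Fin K) (φ : Fin m → Equiv.Perm S)

omit [Fintype S] in
/-- **THE UPDATE KERNEL SPLITS: `Π_w^M = (a·w_0)·Ẽ_0 + Π_{w'}^{N}`** with `N_0 = R`, `N_k = M_k` (`k ≠ 0`),
`w'_0 = (1−a)·w_0`, `w'_k = w_k`, once `M_0 = a·μ_0 + (1−a)·R`. [ours] -/
theorem doeblin_prodKernel_split [Fintype S] {R : S → S → ℝ} (hsplit : ∀ u v, M 0 u v = a * μ 0 v + (1 - a) * R u v)
    {E N : Fin (K + 1) → S → S → ℝ} (hE : ∀ k u v, E k u v = μ k v)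
    (hN : ∀ k u v, N k u v = if k = 0 then R u v else M k u v)
    {w' : Fin (K + 1) → ℝ} (hw' : ∀ k, w' k = if k = 0 then (1 - a) * w 0 else w k) (y z : Fin (K + 1) → S) :
    prodKernel w M y z = a * w 0 * coordKernel E 0 y z + prodKernel w' N y z := by
  rw [prodKernel_apply, prodKernel_apply, Fin.sum_univ_succ, Fin.sum_univ_succ, hw', if_pos rfl]
  have hk : ∀ i : Fin K, w' i.succ * coordKernel N i.succ y z = w i.succ * coordKernel M i.succ y z := by
    intro i
    rw [hw', if_neg (Fin.succ_ne_zero i)]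
    unfold coordKernel
    rw [hN, if_neg (Fin.succ_ne_zero i)]
  simp_rw [hk]
  have h0 : coordKernel M 0 y z = a * coordKernel E 0 y z + (1 - a) * coordKernel N 0 y z := by
    unfold coordKernel
    rw [hE, hN, if_pos rfl]
    split_ifs
    · exact hsplit _ _
    · ring
  rw [h0]
  ring

omit [Fintype S] in
/-- The scheme with the split update kernel is the original scheme. [ours] -/
theorem doeblin_scheme_eq [Fintype S] {R : S → S → ℝ} (hsplit : ∀ u v, M 0 u v = a * μ 0 v + (1 - a) * R u v)
    {E N : Fin (K + 1) → S → S → ℝ} (hE : ∀ k u v, E k u v = μ k v)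
    (hN : ∀ k u v, N k u v = if k = 0 then R u v else M k u v)
    {w' : Fin (K + 1) → ℝ} (hw' : ∀ k, w' k = if k = 0 then (1 - a) * w 0 else w k) :
    (fun y z : Fin (K + 1) → S =>
        t * ptGraphSwap μ (fun r : Fin m => (((0 : Fin (K + 1)), (κ r).succ) : Fin (K + 1) × Fin (K + 1))) φ y z
          + (1 - t) * prodKernel w M y z)
      = (fun y z : Fin (K + 1) → S =>
        t * ptGraphSwap μ (fun r : Fin m => (((0 : Fin (K + 1)), (κ r).succ) : Fin (K + 1) × Fin (K + 1))) φ y z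
          + (1 - t) * (a * w 0 * coordKernel E 0 y z + prodKernel w' N y z)) := by
  funext y z
  rw [doeblin_prodKernel_split hsplit hE hN hw' y z]

/-- The split weights are a probability vector together with `a·w_0`. [ours] -/
theorem doeblin_weights (ha1 : a ≤ 1) (hw0 : ∀ k, 0 ≤ w k) (hw1 : ∑ k, w k = 1)
    {w' : Fin (K + 1) → ℝ} (hw' : ∀ k, w' k = if k = 0 then (1 - a) * w 0 else w k) :
    (∀ k, 0 ≤ w' k) ∧ a * w 0 + ∑ k, w' k = 1 := by
  refine ⟨fun k => ?_, ?_⟩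
  · rw [hw']; split_ifs
    · exact mul_nonneg (by linarith) (hw0 0)
    · exact hw0 k
  · rw [Fin.sum_univ_succ, hw', if_pos rfl]
    simp_rw [hw', if_neg (Fin.succ_ne_zero _)]
    rw [Fin.sum_univ_succ] at hw1
    linarith

omit [DecidableEq S] in
/-- **The residual family:** with `R = (M_0 − a·μ_0)/(1−a)` (`R := μ_0` if `a = 1`) and `N_0 = R`, `N_k = M_k`
(`k ≠ 0`): `M_0 = a·μ_0 + (1−a)·R`, every `N_k` is a transition matrix and `μ_k`-stationary. [ours] -/
theorem doeblin_residualFamily (hM : ∀ k, IsRowStochastic (M k)) (hμ : ∀ k x, 0 < μ k x) (hμ1 : ∀ k, ∑ u, μ k u = 1)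
    (hstat : ∀ (k : Fin (K + 1)) (v : S), ∑ u, μ k u * M k u v = μ k v) (ha1 : a ≤ 1)
    (hmin : ∀ u v, a * μ 0 v ≤ M 0 u v)
    {R : S → S → ℝ} (hR : ∀ u v, R u v = if a < 1 then (M 0 u v - a * μ 0 v) / (1 - a) else μ 0 v)
    {N : Fin (K + 1) → S → S → ℝ} (hN : ∀ k u v, N k u v = if k = 0 then R u v else M k u v) :
    (∀ u v, M 0 u v = a * μ 0 v + (1 - a) * R u v) ∧ (∀ k, IsRowStochastic (N k))
      ∧ (∀ (k : Fin (K + 1)) (v : S), ∑ u, μ k u * N k u v = μ k v) := by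
  have hRrs := doeblinResidual_isRowStochastic (hM 0) (fun v => (hμ 0 v).le) (hμ1 0) hmin hR
  have hRst := doeblinResidual_stationary (hstat 0) (hμ1 0) hR
  have hN0 : N 0 = R := by funext u v; rw [hN, if_pos rfl]
  have hNk : ∀ k : Fin (K + 1), k ≠ 0 → N k = M k := fun k hk => by funext u v; rw [hN, if_neg hk]
  refine ⟨kernel_eq_doeblinResidual_mix (hM 0) (hμ1 0) hmin ha1 hR, fun k => ?_, fun k v => ?_⟩
  · by_cases hk : k = 0
    · subst hk; rw [hN0]; exact hRrs
    · rw [hNk k hk]; exact hM k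
  · by_cases hk : k = 0
    · subst hk; rw [hN0]; exact hRst v
    · rw [hNk k hk]; exact hstat k v

/-! ## §2 The ceilings for a Doeblin-minorised stationary hot kernel -/

/-- **THE DISTANCE PROFILE WITH A DOEBLIN-MINORISED HOT SAMPLER:** `μ_k`-stationary single-site kernels at every
level, hot kernel with `M_0(u,v) ≥ a·μ_0(v)` (`0 < a ≤ 1`), one-sided domination `p·μ_{l_r}(φ_r u) ≤ μ_0(u)`
(`0 < p ≤ 1`), regime `4t ≤ p(1−t)·a·w_0`, hub multiplicities `≥ c`, `1 ≤ c ≤ m`: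
**`d(n) ≤ ((2K+p)/p)·(1 − t·c·p/(2m))ⁿ`.** [ours] -/
theorem doeblinStar_worstTvDist_le (hm : 1 ≤ m) (ht0 : 0 ≤ t) (ht1 : t ≤ 1) (hw0 : ∀ k, 0 ≤ w k) (hw1 : ∑ k, w k = 1)
    (hμ : ∀ k x, 0 < μ k x) (hμ1 : ∀ k, ∑ u, μ k u = 1) (hM : ∀ k, IsRowStochastic (M k))
    (hstat : ∀ (k : Fin (K + 1)) (v : S), ∑ u, μ k u * M k u v = μ k v) (ha0 : 0 < a) (ha1 : a ≤ 1)
    (hmin : ∀ u v, a * μ 0 v ≤ M 0 u v)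
    (hp0 : 0 < p) (hp1 : p ≤ 1) (hdom : ∀ r u, p * μ (κ r).succ (φ r u) ≤ μ 0 u)
    (hreg : 4 * t ≤ p * (1 - t) * (a * w 0))
    {c : ℕ} (hc1 : 1 ≤ c) (hc : ∀ p' : Fin K, c ≤ (univ.filter (fun r : Fin m => κ r = p')).card) (hcm : c ≤ m)
    (n : ℕ) :
    worstTvDist (fun y z : Fin (K + 1) → S =>
        t * ptGraphSwap μ (fun r : Fin m => (((0 : Fin (K + 1)), (κ r).succ) : Fin (K + 1) × Fin (K + 1))) φ y z
          + (1 - t) * prodKernel w M y z) (tensorFun μ) n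
      ≤ (2 * (K : ℝ) + p) / p * (1 - t * c * p / (2 * m)) ^ n := by
  set R : S → S → ℝ := fun u v => if a < 1 then (M 0 u v - a * μ 0 v) / (1 - a) else μ 0 v with hR_def
  have hR : ∀ u v, R u v = if a < 1 then (M 0 u v - a * μ 0 v) / (1 - a) else μ 0 v := fun _ _ => rfl
  set E : Fin (K + 1) → S → S → ℝ := fun k _ v => μ k v with hE_def
  have hE : ∀ k u v, E k u v = μ k v := fun _ _ _ => rfl
  set N : Fin (K + 1) → S → S → ℝ := fun k u v => if k = 0 then R u v else M k u v with hN_def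
  have hN : ∀ k u v, N k u v = if k = 0 then R u v else M k u v := fun _ _ _ => rfl
  set w' : Fin (K + 1) → ℝ := fun k => if k = 0 then (1 - a) * w 0 else w k with hw'_def
  have hw' : ∀ k, w' k = if k = 0 then (1 - a) * w 0 else w k := fun _ => rfl
  obtain ⟨hsplit, hNrs, hNst⟩ := doeblin_residualFamily hM hμ hμ1 hstat ha1 hmin hR hN
  obtain ⟨hw'0, hw'1⟩ := doeblin_weights ha1 hw0 hw1 hw'
  rw [doeblin_scheme_eq κ φ hsplit hE hN hw']
  exact refreshStar_worstTvDist_le κ φ hm ht0 ht1 (mul_nonneg ha0.le (hw0 0)) hw'0 hw'1 hμ hμ1 hNrs hE hNst hp0 hp1 hdom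
    hreg hc1 hc hcm n

/-- **THE MIXING CEILING WITH A DOEBLIN-MINORISED HOT SAMPLER: `t_mix(ε) ≤ ⌈(2m/(tcp))·log((2K+p)/(pε))⌉`** once
`4t ≤ p(1−t)·a·w_0` (`0 < t`). [ours] -/
theorem doeblinStar_mixingTime_le (hm : 1 ≤ m) (ht0 : 0 < t) (ht1 : t ≤ 1) (hw0 : ∀ k, 0 ≤ w k) (hw1 : ∑ k, w k = 1)
    (hμ : ∀ k x, 0 < μ k x) (hμ1 : ∀ k, ∑ u, μ k u = 1) (hM : ∀ k, IsRowStochastic (M k))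
    (hstat : ∀ (k : Fin (K + 1)) (v : S), ∑ u, μ k u * M k u v = μ k v) (ha0 : 0 < a) (ha1 : a ≤ 1)
    (hmin : ∀ u v, a * μ 0 v ≤ M 0 u v)
    (hp0 : 0 < p) (hp1 : p ≤ 1) (hdom : ∀ r u, p * μ (κ r).succ (φ r u) ≤ μ 0 u)
    (hreg : 4 * t ≤ p * (1 - t) * (a * w 0))
    {c : ℕ} (hc1 : 1 ≤ c) (hc : ∀ p' : Fin K, c ≤ (univ.filter (fun r : Fin m => κ r = p')).card) (hcm : c ≤ m)
    {ε : ℝ} (hε : 0 < ε) :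
    mixingTime (fun y z : Fin (K + 1) → S =>
        t * ptGraphSwap μ (fun r : Fin m => (((0 : Fin (K + 1)), (κ r).succ) : Fin (K + 1) × Fin (K + 1))) φ y z
          + (1 - t) * prodKernel w M y z) (tensorFun μ) ε
      ≤ ⌈2 * (m : ℝ) / (t * c * p) * Real.log ((2 * (K : ℝ) + p) / (p * ε))⌉₊ := by
  set R : S → S → ℝ := fun u v => if a < 1 then (M 0 u v - a * μ 0 v) / (1 - a) else μ 0 v with hR_def
  have hR : ∀ u v, R u v = if a < 1 then (M 0 u v - a * μ 0 v) / (1 - a) else μ 0 v := fun _ _ => rfl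
  set E : Fin (K + 1) → S → S → ℝ := fun k _ v => μ k v with hE_def
  have hE : ∀ k u v, E k u v = μ k v := fun _ _ _ => rfl
  set N : Fin (K + 1) → S → S → ℝ := fun k u v => if k = 0 then R u v else M k u v with hN_def
  have hN : ∀ k u v, N k u v = if k = 0 then R u v else M k u v := fun _ _ _ => rfl
  set w' : Fin (K + 1) → ℝ := fun k => if k = 0 then (1 - a) * w 0 else w k with hw'_def
  have hw' : ∀ k, w' k = if k = 0 then (1 - a) * w 0 else w k := fun _ => rfl
  obtain ⟨hsplit, hNrs, hNst⟩ := doeblin_residualFamily hM hμ hμ1 hstat ha1 hmin hR hN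
  obtain ⟨hw'0, hw'1⟩ := doeblin_weights ha1 hw0 hw1 hw'
  rw [doeblin_scheme_eq κ φ hsplit hE hN hw']
  exact refreshStar_mixingTime_le κ φ hm ht0 ht1 (mul_nonneg ha0.le (hw0 0)) hw'0 hw'1 hμ hμ1 hNrs hE hNst hp0 hp1 hdom
    hreg hc1 hc hcm hε

/-- **PERFECT TRANSPORTS WITH A DOEBLIN-MINORISED HOT SAMPLER:** `μ_{l_r}(φ_r u) = μ_0(u)`, `0 < t < 1`, `w_0 > 0`,
`0 < a ≤ 1`: **`d(n) ≤ 2(K+1)·(1 − t(1−t)·a·w_0·c/(2m))ⁿ`** — no regime. [ours] -/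
theorem doeblinPerfectStar_worstTvDist_le (hm : 1 ≤ m) (ht0 : 0 < t) (ht1 : t < 1) (hw0 : ∀ k, 0 ≤ w k)
    (hw00 : 0 < w 0) (hw1 : ∑ k, w k = 1) (hμ : ∀ k x, 0 < μ k x) (hμ1 : ∀ k, ∑ u, μ k u = 1)
    (hM : ∀ k, IsRowStochastic (M k)) (hstat : ∀ (k : Fin (K + 1)) (v : S), ∑ u, μ k u * M k u v = μ k v)
    (ha0 : 0 < a) (ha1 : a ≤ 1) (hmin : ∀ u v, a * μ 0 v ≤ M 0 u v) (hperf : ∀ r u, μ (κ r).succ (φ r u) = μ 0 u)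
    {c : ℕ} (hc1 : 1 ≤ c) (hc : ∀ p' : Fin K, c ≤ (univ.filter (fun r : Fin m => κ r = p')).card) (hcm : c ≤ m)
    (n : ℕ) :
    worstTvDist (fun y z : Fin (K + 1) → S =>
        t * ptGraphSwap μ (fun r : Fin m => (((0 : Fin (K + 1)), (κ r).succ) : Fin (K + 1) × Fin (K + 1))) φ y z
          + (1 - t) * prodKernel w M y z) (tensorFun μ) n
      ≤ 2 * ((K : ℝ) + 1) * (1 - t * (1 - t) * (a * w 0) * c / (2 * m)) ^ n := by
  set R : S → S → ℝ := fun u v => if a < 1 then (M 0 u v - a * μ 0 v) / (1 - a) else μ 0 v with hR_def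
  have hR : ∀ u v, R u v = if a < 1 then (M 0 u v - a * μ 0 v) / (1 - a) else μ 0 v := fun _ _ => rfl
  set E : Fin (K + 1) → S → S → ℝ := fun k _ v => μ k v with hE_def
  have hE : ∀ k u v, E k u v = μ k v := fun _ _ _ => rfl
  set N : Fin (K + 1) → S → S → ℝ := fun k u v => if k = 0 then R u v else M k u v with hN_def
  have hN : ∀ k u v, N k u v = if k = 0 then R u v else M k u v := fun _ _ _ => rfl
  set w' : Fin (K + 1) → ℝ := fun k => if k = 0 then (1 - a) * w 0 else w k with hw'_def
  have hw' : ∀ k, w' k = if k = 0 then (1 - a) * w 0 else w k := fun _ => rfl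
  obtain ⟨hsplit, hNrs, hNst⟩ := doeblin_residualFamily hM hμ hμ1 hstat ha1 hmin hR hN
  obtain ⟨hw'0, hw'1⟩ := doeblin_weights ha1 hw0 hw1 hw'
  rw [doeblin_scheme_eq κ φ hsplit hE hN hw']
  exact refreshPerfectStar_worstTvDist_le κ φ hm ht0 ht1 (mul_pos ha0 hw00) hw'0 hw'1 hμ hμ1 hNrs hE hNst hperf hc1 hc hcm n

/-- **THE MIXING CEILING WITH PERFECT TRANSPORTS AND A DOEBLIN-MINORISED HOT SAMPLER:
`t_mix(ε) ≤ ⌈(2m/(t(1−t)·a·w_0·c))·log(2(K+1)/ε)⌉`.** [ours] -/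
theorem doeblinPerfectStar_mixingTime_le (hm : 1 ≤ m) (ht0 : 0 < t) (ht1 : t < 1) (hw0 : ∀ k, 0 ≤ w k)
    (hw00 : 0 < w 0) (hw1 : ∑ k, w k = 1) (hμ : ∀ k x, 0 < μ k x) (hμ1 : ∀ k, ∑ u, μ k u = 1)
    (hM : ∀ k, IsRowStochastic (M k)) (hstat : ∀ (k : Fin (K + 1)) (v : S), ∑ u, μ k u * M k u v = μ k v)
    (ha0 : 0 < a) (ha1 : a ≤ 1) (hmin : ∀ u v, a * μ 0 v ≤ M 0 u v) (hperf : ∀ r u, μ (κ r).succ (φ r u) = μ 0 u)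
    {c : ℕ} (hc1 : 1 ≤ c) (hc : ∀ p' : Fin K, c ≤ (univ.filter (fun r : Fin m => κ r = p')).card) (hcm : c ≤ m)
    {ε : ℝ} (hε : 0 < ε) :
    mixingTime (fun y z : Fin (K + 1) → S =>
        t * ptGraphSwap μ (fun r : Fin m => (((0 : Fin (K + 1)), (κ r).succ) : Fin (K + 1) × Fin (K + 1))) φ y z
          + (1 - t) * prodKernel w M y z) (tensorFun μ) ε
      ≤ ⌈2 * (m : ℝ) / (t * (1 - t) * (a * w 0) * c) * Real.log (2 * ((K : ℝ) + 1) / ε)⌉₊ := by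
  set R : S → S → ℝ := fun u v => if a < 1 then (M 0 u v - a * μ 0 v) / (1 - a) else μ 0 v with hR_def
  have hR : ∀ u v, R u v = if a < 1 then (M 0 u v - a * μ 0 v) / (1 - a) else μ 0 v := fun _ _ => rfl
  set E : Fin (K + 1) → S → S → ℝ := fun k _ v => μ k v with hE_def
  have hE : ∀ k u v, E k u v = μ k v := fun _ _ _ => rfl
  set N : Fin (K + 1) → S → S → ℝ := fun k u v => if k = 0 then R u v else M k u v with hN_def
  have hN : ∀ k u v, N k u v = if k = 0 then R u v else M k u v := fun _ _ _ => rfl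
  set w' : Fin (K + 1) → ℝ := fun k => if k = 0 then (1 - a) * w 0 else w k with hw'_def
  have hw' : ∀ k, w' k = if k = 0 then (1 - a) * w 0 else w k := fun _ => rfl
  obtain ⟨hsplit, hNrs, hNst⟩ := doeblin_residualFamily hM hμ hμ1 hstat ha1 hmin hR hN
  obtain ⟨hw'0, hw'1⟩ := doeblin_weights ha1 hw0 hw1 hw'
  rw [doeblin_scheme_eq κ φ hsplit hE hN hw']
  exact refreshPerfectStar_mixingTime_le κ φ hm ht0 ht1 (mul_pos ha0 hw00) hw'0 hw'1 hμ hμ1 hNrs hE hNst hperf hc1 hc hcm hε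

end Doeblin

end Summit.Ventures.LatticeQCDFlow.Scaling

end
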